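import Summits.BirchSwinnertonDyer.BirchSwinnertonDyer.Theorems.UniversalToricDescentTwinFramesAtThreeOfTresSelfDual
import HarnessLib

/-!
# SKELETON PROPOSAL v17′ (line `membertower`, crux ♭B′° `TwinDegreeFrameAtThreeMultTresT` = stmt-BirchSwinnertonDyer-22539 ONLY;
# width seat bsd-wall-utd-b-w1 g2 re-publication of g0's v17′ (evidence #13 on 22539, 2026-08-29T00:43:52Z, whose crux write was refused
# rc 75 ×22 by the farm) — ENDORSED by pen pss3x g7 (STATUS 2026-08-29T01:06:02Z (b)) as the next skeleton of record; NOT registered here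
# (registration = the crux LEAD's `ledger skeleton check`, single-slot rule)

v17′ = v16 (LEAD utd-p2 g18, 8c09f9fed2825b17) MINUS `stub_thmB` (Hsieh Thm B, PUB 20711: not needed for the DEGREE clause, p680907) and with
the research stub keyed by its TRUE name, the two-variable Σ-imprimitive core TV₃† on the self-dual module (text = hypothesis `hTV` of p663826 §1†
= of p682284 §2 VERBATIM), instead of K1♯† (item 23310): the TV₃† road delivers K1♯† exactly on the très-ramifié locus (p682284 §2
`tresSelfDual_of_twoVarCoreAtThreeDagger : TV₃† → K1♯†_T`), which is all ♭B′° reads. Two stubs: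

* `stub_pubMembersFramesCongruence` := `Castella2018.castella2020_thm211_members_frames_sigma_congruence_odd_nonsplit_wt` (item 23284, PUB BY NAME) — v16 VERBATIM.
* `stub_twoVarCoreAtThreeDagger` := TV₃† (RESEARCH; no Eisenstein-side two-variable engine in print at `p = 3`).

Composition: `TwinDegreeFrameAtThreeMultTresT_of` := p682999 §5
`UniversalToricDescentTwinFramesAtThreeOfTresSelfDual.twinDegreeFrameAtThreeMultTresT_of_nonsplitWtMembersFrames_of_twoVarCoreAtThreeDagger`
(= §4 ∘ `allSplitWtMembersFrames_of_nonsplitWtMembersFrames` ∘ p682284 §2). INDEPENDENT of the pen's T2 (23310 ↦ K1♯†_T): no decl of this file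
reads item 23310 by name. lean rc 0 expected with exactly 2 sorries (the stubs); the crux concluded BY NAME. ♭B′ 27401 keeps v16/v17 (3 stubs,
Thm B needed there). BSD is not proved by any of this; every `sorry` below is a stub.
[cite: Castella2020JIMJ, Thm. 2.11] [cite: Castella2018Erratum, §2 (p. 2), Lemma 2.1, proof of Thm. 1.1 (a)(b)(c)] [cite: JetchevSkinnerWan2017, §3.4, Cor. 3.4.2]
[cite: Skinner2016PacificMC, §2.6 (2-6-1), §3.1]
-/

noncomputable section

open scoped Classical

set_option linter.dupNamespace false
set_option autoImplicit false

namespace Summit.BirchSwinnertonDyer.BirchSwinnertonDyer.Cruxes.TwinDegreeFrameAtThreeMultTresT.MemberTower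

open PowerSeries WeierstrassCurve NumberField IsDedekindDomain Field
  Literature.NumberTheory.EllipticCurves
  Literature.NumberTheory.EllipticCurves.ModularForms
  Literature.NumberTheory.EllipticCurves.Rank1Residual
  Literature.NumberTheory.EllipticCurves.BigGaloisRep
  Literature.NumberTheory.EllipticCurves.GreenbergSelmer
  Literature.NumberTheory.GaloisRepresentations
  Summit.BirchSwinnertonDyer.Rank1Residual.X11b
  Summit.BirchSwinnertonDyer.Rank1Residual.X11b.Halves
  Summit.BirchSwinnertonDyer.BirchSwinnertonDyer.Theorems.SchneiderFree
  Summit.BirchSwinnertonDyer.BirchSwinnertonDyer.Theorems.UniversalToricDescentTwinWanFrameAtThreeMultTresTAllSplitSelfDual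
  Summit.BirchSwinnertonDyer.BirchSwinnertonDyer.Theorems.UniversalToricDescentTwinSelfDualMemberRationalInclusionAtThreeTres
  Summit.BirchSwinnertonDyer.BirchSwinnertonDyer.Theorems.UniversalToricDescentTwinFramesAtThreeOfTresSelfDual
  Summit.BirchSwinnertonDyer.BirchSwinnertonDyer.Theses.UniversalToricDescent
  Summit.BirchSwinnertonDyer.BirchSwinnertonDyer.Theorems

/-- STUB (BY NAME = item stmt-BirchSwinnertonDyer-23284 `TwinCastellaMembersFramesCongruenceOddInput` at route rev 72, the
weight-sharpened supply 22593†; PUBLISHED by reading; closes only by formalisation): Castella JIMJ 2020 §2 Def. 2.10 / Thm. 2.11 at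
an odd prime WITH the erratum's hypothesis (iii), members chosen with `2(p−1)p^{m−1} ∣ k_m − 2` (free in print: Skinner 2016 §2.6).
[cite: Castella2020JIMJ, §2 Def. 2.10, Thm. 2.11] [cite: Castella2018Erratum, Thm. 1.1 (iii), proof (a)(b)] [cite: Skinner2016PacificMC, §2.6 (2-6-1), §3.1] -/
theorem stub_pubMembersFramesCongruence :
    Castella2018.castella2020_thm211_members_frames_sigma_congruence_odd_nonsplit_wt := by
  sorry

set_option maxHeartbeats 800000 in
-- statement-sized binders over the big two-variable representation (as p663826 / p682284); nothing is proved here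
/-- STUB (RESEARCH, hardest stub) **TV₃†** — the two-variable Σ-imprimitive Greenberg-side divisibility on the SELF-DUAL module
`AnticyclotomicBigGaloisRep κ (D.Δ.selfDualCofreeRepOver K)` over `𝒪⟦T_c⟧⟦T⟧`, pinned on `T_c = 0` to the member's Σ-frame `Q` up to a unit,
for every Hida member `D` of depth `m ≥ 1` with `2(3−1)3^{m−1} ∣ k_m − 2`, `ρ̄` irreducible, the (dec)† binder «no non-zero `Γ_{K_𝔭′}`-fixed
`3`-power torsion in `A†_g`», `ι′`-compatibility, every characterised receptacle `b`, every Σ-frame, every CYCLOTOMIC `κ′`: text = hypothesis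
`hTV` of p663826 §1† / p682284 §2 VERBATIM. Intended engine: a two-variable Eisenstein-congruence / Euler-system divisibility at `p = 3` for a
member of weight `k_m` — NOT in print ([SkinnerUrban2014] Thm. 3.26 / [JetchevSkinnerWan2017] Thm. 3.3.3 are `p ≥ 5` / good ordinary;
[KingsLoefflerZerbes2017] §7–8 needs `p ∤ 6N`). Closes K1♯†_T by p682284 §2 and ♭B′° by p682999 §5.
[cite: JetchevSkinnerWan2017, §3.4, Lemma 3.4.1, Cor. 3.4.2 (arXiv:1512.06894 p. 14)] [cite: Castella2018Erratum, §2 (p. 2), Lemma 2.1, (2.4)–(2.5)]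
[cite: SkinnerUrban2014, Thm. 3.26, Prop. 3.23] -/
theorem stub_twoVarCoreAtThreeDagger :
    ∀ (W' : WeierstrassCurve ℚ) [W'.IsElliptic] [W'.IsGloballyMinimal] (N' : ℕ) [NeZero N']
      (K : Type) [Field K] [NumberField K] (Dt' : ModularParametrizationData W' N'),
      Mult W' 3 → W'.HasSurjectiveModNGaloisRep 3 → W'.conductorNorm ℤ = N' → IsImaginaryQuadratic K →
      SatisfiesHeegnerHypothesis N' K → Odd (NumberField.discr K) →
      ∀ (κ : ZpExtension K 3), κ.IsAnticyclotomic → ∀ (γ : absoluteGaloisGroup K) [Fact (κ.IsTopGenerator γ)]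
        (𝔭 : HeightOneSpectrum (𝓞 K)), ((3 : ℕ) : 𝓞 K) ∈ 𝔭.asIdeal →
        𝔭.asIdeal.ramificationIdx (𝓞 ℚ) = 1 → 𝔭.asIdeal.inertiaDeg (𝓞 ℚ) = 1 →
        ∀ (𝔭' : HeightOneSpectrum (𝓞 K)), ((3 : ℕ) : 𝓞 K) ∈ 𝔭'.asIdeal → 𝔭' ≠ 𝔭 →
        ∀ (ι' : PadicAlgCl 3 ≃+* ℂ), BranchInducesPrime 3 ι' 𝔭 →
        ∀ (m : ℕ), 1 ≤ m → ∀ (D : Skinner2016.HidaCongruentMember W' 3 m),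
          (2 * (((3 : ℕ) : ℤ) - 1) * ((3 : ℕ) : ℤ) ^ (m - 1)) ∣ D.k - 2 →
          SkinnerUrban2014.IsResiduallyIrreducible D.Δ →
          (∀ a : Cofree D.Δ.selfDualRep (padicCoeffField D.ι),
              (∀ σ : LocalGroup K (Sum.inl 𝔭'), (D.Δ.selfDualCofreeRepOver K) (localMap K (Sum.inl 𝔭') σ) a = a) →
              (∃ j : ℕ, (3 : ℕ) ^ j • a = 0) → a = 0) →
          (∀ x : coeffField D.g, ι' (D.ι x) = (x : ℂ)) →
        ∀ (b : padicCoeffIntegers D.ι →+* 𝓞_ℂ_[3]),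
          (∀ x, ((b x : 𝓞_ℂ_[3]) : ℂ_[3]) = algebraMap (PadicAlgCl 3) ℂ_[3] (padicCoeffIntegers.toPadicAlgCl D.ι x)) →
        ∀ (ΩK : ℂ) (Ωp : (𝓞_ℂ_[3])ˣ) (Q : PowerSeries 𝓞_ℂ_[3]), ΩK ≠ 0 →
          IsBDPLFunctionWtSigmaInt ι' 𝔭 κ γ D.g (W'.sigmaPlacesFinset 3 K) ΩK ((Ωp : 𝓞_ℂ_[3]) : ℂ_[3]) Q →
        ∀ (κ' : ZpExtension K 3) (γ' : absoluteGaloisGroup K) [Fact (κ'.IsTopGenerator γ')], κ'.IsCyclotomic →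
        ∀ [TopologicalSpace (PowerSeries (padicCoeffIntegers D.ι))]
          [TopologicalSpace (PowerSeries (PowerSeries (padicCoeffIntegers D.ι)))]
          [ContinuousSMul (PowerSeries (PowerSeries (padicCoeffIntegers D.ι)))
            (BigRepModule (PowerSeries (padicCoeffIntegers D.ι)) 3
              (BigRepModule (padicCoeffIntegers D.ι) 3 (Cofree D.Δ.selfDualRep (padicCoeffField D.ι))))],
          Module.IsTorsion (PowerSeries (PowerSeries (padicCoeffIntegers D.ι)))
              (XBig κ' (AnticyclotomicBigGaloisRep κ (D.Δ.selfDualCofreeRepOver K)) 𝔭' (↑(W'.sigmaPlacesFinset 3 K))) →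
            ∃ Q₂ : PowerSeries (PowerSeries 𝓞_ℂ_[3]),
              (∃ u : (PowerSeries 𝓞_ℂ_[3])ˣ, PowerSeries.constantCoeff Q₂ = (u : PowerSeries 𝓞_ℂ_[3]) * Q) ∧
              (XBig.charIdeal κ' (AnticyclotomicBigGaloisRep κ (D.Δ.selfDualCofreeRepOver K)) 𝔭'
                  (↑(W'.sigmaPlacesFinset 3 K))).map (PowerSeries.map (PowerSeries.map b)) ≤ Ideal.span {Q₂} := by
  sorry

/-- COMPOSITION (v17′, act DEG): ♭B′° `TwinDegreeFrameAtThreeMultTresT` (item stmt-BirchSwinnertonDyer-22539) BY NAME from the TWO stubs through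
p682999 §5 (supply frame from the fact†, TV₃† → K1♯†_T by p682284 §2, (dec) from the très-ramifié binder, `μ(L) = 0` from the degree clause's own
profile hypothesis, self-dual member tower, `degreeClause_of_wanClause`). [folklore] -/
theorem TwinDegreeFrameAtThreeMultTresT_of :
    Summit.BirchSwinnertonDyer.BirchSwinnertonDyer.Theses.UniversalToricDescent.TwinDegreeFrameAtThreeMultTresT :=
  Summit.BirchSwinnertonDyer.BirchSwinnertonDyer.Theorems.UniversalToricDescentTwinFramesAtThreeOfTresSelfDual.twinDegreeFrameAtThreeMultTresT_of_nonsplitWtMembersFrames_of_twoVarCoreAtThreeDagger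
    stub_pubMembersFramesCongruence stub_twoVarCoreAtThreeDagger

end Summit.BirchSwinnertonDyer.BirchSwinnertonDyer.Cruxes.TwinDegreeFrameAtThreeMultTresT.MemberTower

end
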